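import Mathlib

/-!
# The Selberg/Harish-Chandra transform and the test kernel of the hyperbolic circle problem
(Iwaniec, *Spectral Methods of Automorphic Forms*, GSM 53, (1.62)–(1.63) and Chapter 12)

Fourth layer (part a) of the `provefact` decomposition of `Literature.NumberTheory.Automorphic.sl2BallCount_asymp`
(`Literature/NumberTheory/Automorphic/HyperbolicLatticeCount.lean`, Iwaniec Cor. 12.2): the
elementary real analysis entering Iwaniec's proof of Theorem 12.1 (PDF p. 126), independent of the
spectral theory. Held copy: `book:iwaniec2002-spectral-methods-automorphic-forms`.

## Contents

* `selbergQ`, `selbergG`, `selbergTransform`: the three steps (1.62), PDF p. 24,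
  `q(v) = ∫_v^∞ k(u)(u - v)^{-1/2} du`, `g(r) = 2q(sinh²(r/2))`, `h(t) = ∫ e^{irt} g(r) dr`
  (`t ∈ ℂ`). By Theorem 1.16, `h(t)` is the eigenvalue of the invariant integral operator with
  kernel `k(u(z, w))` on eigenfunctions of `Δ` with `λ = s(1 - s)`, `s = 1/2 + it`.
* `IsTestKernel k`: `k` measurable, bounded, `k(u) = 0` for `u ≥ M` — the generality in which the
  elementary theory below is developed (covers the kernels of §7.2 and Chapter 12).
* PROVED: `B(1/2, 1/2) = π` (`integral_rpow_neg_half_mul`), boundedness/support/measurability of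
  `q`, `g`, convergence of `h(t)` for all `t ∈ ℂ`, `h` even (`selbergTransform_neg`) and entire
  (`differentiable_selbergTransform`), and the **mass formula**
  `selbergTransform_I_half : h(i/2) = 4π ∫_0^∞ k(u) du` (Thm 1.16 at `s = 1`; §7.2, PDF p. 73:
  "for `s = 0` [sic, `λ = 0`] this gives `h(i/2) = ∫_ℍ k(i, z) dμz`"), which produces the main
  term `2π|F|⁻¹X` of Theorem 12.1.
* `IsAdmissibleTransform h`: the conditions (1.63), PDF p. 24 (even, holomorphic in a strip
  `|Im t| < 1/2 + ε`, `h(t) ≪ (|t| + 1)^{-2-ε}` there) — the hypotheses of Theorem 7.4 / (7.17).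
* `latticeKernel X Y`: the test function of Fig. 11, PDF p. 126 (`= 1` for `4u + 2 ≤ X`, `= 0` for
  `4u + 2 ≥ X + Y`, linear in between), with the sandwich inequalities behind (12.7)
  (`indicator_le_latticeKernel`, `latticeKernel_sub_le_indicator`), its mass
  `∫ k = (X - 2)/4 + Y/8` and hence `h(i/2) = π(X - 2 + Y/2)` exactly
  (`selbergTransform_latticeKernel_I_half`), i.e. (12.8) at `s = 1` with an explicit `O(Y)`
  (`Iwaniec2002_eq_12_8_one`, PROVED).
* NAMED FACTS ("We let the reader prove that ...", PDF p. 126): `Iwaniec2002_eq_12_8` ((12.8) for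
  `1/2 < s ≤ 1`), `Iwaniec2002_eq_12_9` ((12.9) on `Re s = 1/2`, majorant `majorant129`), and
  `Iwaniec2002_latticeKernel_admissible` ((1.63) for this kernel, used implicitly when the book
  applies (12.5) to it).
* PROVED: the calculus of the majorant `H(t) = |s|^{-5/2}(min{|s|, T} + log X) X^{1/2}` of (12.9):
  `H` is decreasing on `[0, ∞)` (`majorant129_antitoneOn`, as (12.5) requires), `H(0) ≪ X^{1/2}
  log X`, and `∫_0^∞ (t + 1) H(t) dt ≤ 8 X Y^{-1/2} + c X^{1/2} log X`
  (`integral_majorant129_le`) — the computation behind "`O(Y + XY^{-1/2})`" in the proof of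
  Theorem 12.1.

Part b (separate file, needs `HyperbolicLaplaceSpectrum`): the automorphic kernel
`K(z, w) = Σ_γ k(u(γz, w))`, (12.5) as a named fact (Thm 7.4 + Prop. 7.2), (12.7), and the
derivation of Theorem 12.1 from (12.5), (12.8), (12.9).

Mathlib search: no Selberg/Harish-Chandra transform, no point-pair-invariant operators
(`lean search 'selberg|Harish|pretrace'`: only Selberg sieve / Selberg class hits).
-/

noncomputable section

namespace Literature.NumberTheory.Automorphic

open MeasureTheory Set Filter Real
open scoped Topology

/-! ## The Selberg/Harish-Chandra transform (1.62) -/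

/-- First step of the Selberg/Harish-Chandra transform (Iwaniec (1.62)):
`q(v) = ∫_v^∞ k(u) (u - v)^{-1/2} du`. [cite: Iwaniec2002, (1.62), PDF p. 24] -/
def selbergQ (k : ℝ → ℝ) (v : ℝ) : ℝ :=
  ∫ u in Ioi v, k u * (u - v) ^ (-(1 / 2 : ℝ))

/-- Second step of the Selberg/Harish-Chandra transform (Iwaniec (1.62)):
`g(r) = 2 q(sinh²(r/2))`. [cite: Iwaniec2002, (1.62), PDF p. 24] -/
def selbergG (k : ℝ → ℝ) (r : ℝ) : ℝ :=
  2 * selbergQ k (Real.sinh (r / 2) ^ 2)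

/-- Third step of the Selberg/Harish-Chandra transform (Iwaniec (1.62)):
`h(t) = ∫_{-∞}^{∞} e^{irt} g(r) dr`, for complex `t` (for compactly supported bounded `k` the
integral converges for every `t ∈ ℂ` and `h` is entire and even). By Theorem 1.16, `h(t)` is the
eigenvalue of the invariant integral operator with kernel `k(u(z, w))` on any eigenfunction of `Δ`
with eigenvalue `λ = s(1 - s)`, `s = 1/2 + it`. [cite: Iwaniec2002, (1.62) & Thm 1.16, PDF p. 24] -/
def selbergTransform (k : ℝ → ℝ) (t : ℂ) : ℂ :=
  ∫ r : ℝ, Complex.exp (Complex.I * r * t) * (selbergG k r : ℂ)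

/-! ## The Beta integral `B(1/2, 1/2) = π` -/

/-- `∫_0^1 w^{-1/2} (1 - w)^{-1/2} dw` converges (comparison with `w^{-1/2}` and `(1-w)^{-1/2}`).
[folklore] -/
theorem intervalIntegrable_rpow_neg_half_mul :
    IntervalIntegrable (fun w : ℝ => w ^ (-(1 / 2 : ℝ)) * (1 - w) ^ (-(1 / 2 : ℝ))) volume 0 1 := by
  have hm : AEStronglyMeasurable (fun w : ℝ => w ^ (-(1 / 2 : ℝ)) * (1 - w) ^ (-(1 / 2 : ℝ)))
      volume := by
    apply Measurable.aestronglyMeasurable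
    fun_prop
  have h1 : IntervalIntegrable (fun w : ℝ => w ^ (-(1 / 2 : ℝ)) * (1 - w) ^ (-(1 / 2 : ℝ)))
      volume 0 (1 / 2) := by
    have hg : IntervalIntegrable (fun w : ℝ => Real.sqrt 2 * w ^ (-(1 / 2 : ℝ))) volume 0 (1 / 2) :=
      (intervalIntegral.intervalIntegrable_rpow' (by norm_num)).const_mul _
    refine hg.mono_fun' hm.restrict ?_
    rw [Set.uIoc_of_le (by norm_num : (0 : ℝ) ≤ 1 / 2)]
    filter_upwards [ae_restrict_mem measurableSet_Ioc] with w hw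
    rcases hw with ⟨hw0, hw1⟩
    have hA : 0 ≤ w ^ (-(1 / 2 : ℝ)) := Real.rpow_nonneg hw0.le _
    have hB : 0 ≤ (1 - w) ^ (-(1 / 2 : ℝ)) := Real.rpow_nonneg (by linarith) _
    have hB' : (1 - w) ^ (-(1 / 2 : ℝ)) ≤ Real.sqrt 2 := by
      have h := Real.rpow_le_rpow_of_nonpos (by norm_num : (0 : ℝ) < 1 / 2) (by linarith : 1 / 2 ≤ 1 - w)
        (by norm_num : (-(1 / 2 : ℝ)) ≤ 0)
      refine h.trans (le_of_eq ?_)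
      rw [Real.sqrt_eq_rpow, Real.rpow_neg (by norm_num), ← Real.inv_rpow (by norm_num)]
      norm_num
    rw [Real.norm_eq_abs, abs_of_nonneg (mul_nonneg hA hB)]
    calc w ^ (-(1 / 2 : ℝ)) * (1 - w) ^ (-(1 / 2 : ℝ)) ≤ w ^ (-(1 / 2 : ℝ)) * Real.sqrt 2 :=
          mul_le_mul_of_nonneg_left hB' hA
      _ = Real.sqrt 2 * w ^ (-(1 / 2 : ℝ)) := by ring
  have h2 : IntervalIntegrable (fun w : ℝ => w ^ (-(1 / 2 : ℝ)) * (1 - w) ^ (-(1 / 2 : ℝ)))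
      volume (1 / 2) 1 := by
    have hg0 : IntervalIntegrable (fun w : ℝ => w ^ (-(1 / 2 : ℝ))) volume (1 / 2) 0 :=
      intervalIntegral.intervalIntegrable_rpow' (by norm_num)
    have hg1 : IntervalIntegrable (fun w : ℝ => (1 - w) ^ (-(1 / 2 : ℝ))) volume (1 - 1 / 2) (1 - 0) :=
      hg0.comp_sub_left 1
    have hg : IntervalIntegrable (fun w : ℝ => Real.sqrt 2 * (1 - w) ^ (-(1 / 2 : ℝ))) volume
        (1 / 2) 1 := by
      have := hg1.const_mul (Real.sqrt 2)
      norm_num at this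
      exact this
    refine hg.mono_fun' hm.restrict ?_
    rw [Set.uIoc_of_le (by norm_num : (1 / 2 : ℝ) ≤ 1)]
    filter_upwards [ae_restrict_mem measurableSet_Ioc] with w hw
    rcases hw with ⟨hw0, hw1⟩
    have hA : 0 ≤ w ^ (-(1 / 2 : ℝ)) := Real.rpow_nonneg (by linarith) _
    have hB : 0 ≤ (1 - w) ^ (-(1 / 2 : ℝ)) := Real.rpow_nonneg (by linarith) _
    have hA' : w ^ (-(1 / 2 : ℝ)) ≤ Real.sqrt 2 := by
      have h := Real.rpow_le_rpow_of_nonpos (by norm_num : (0 : ℝ) < 1 / 2) hw0.le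
        (by norm_num : (-(1 / 2 : ℝ)) ≤ 0)
      refine h.trans (le_of_eq ?_)
      rw [Real.sqrt_eq_rpow, Real.rpow_neg (by norm_num), ← Real.inv_rpow (by norm_num)]
      norm_num
    rw [Real.norm_eq_abs, abs_of_nonneg (mul_nonneg hA hB)]
    exact mul_le_mul_of_nonneg_right hA' hB
  exact h1.trans h2

/-- The Beta integral `B(1/2, 1/2) = ∫_0^1 w^{-1/2} (1 - w)^{-1/2} dw = π`
(antiderivative `arcsin(2w - 1)`). [folklore] -/
theorem integral_rpow_neg_half_mul :
    ∫ w in (0 : ℝ)..1, w ^ (-(1 / 2 : ℝ)) * (1 - w) ^ (-(1 / 2 : ℝ)) = π := by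
  have hderiv : ∀ w ∈ Ioo (0 : ℝ) 1,
      HasDerivAt (fun w : ℝ => Real.arcsin (2 * w - 1)) (w ^ (-(1 / 2 : ℝ)) * (1 - w) ^ (-(1 / 2 : ℝ))) w := by
    intro w hw
    rcases hw with ⟨hw0, hw1⟩
    have h1 : (2 * w - 1) ≠ -1 := by intro h; linarith
    have h2 : (2 * w - 1) ≠ 1 := by intro h; linarith
    have hlin : HasDerivAt (fun w : ℝ => 2 * w - 1) 2 w := by
      simpa using ((hasDerivAt_id w).const_mul (2 : ℝ)).sub_const (1 : ℝ)
    have h := (Real.hasDerivAt_arcsin h1 h2).comp w hlin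
    refine h.congr_deriv ?_
    have hsq : 1 - (2 * w - 1) ^ 2 = 4 * (w * (1 - w)) := by ring
    rw [hsq, Real.sqrt_mul (by norm_num), show Real.sqrt 4 = 2 by
      rw [show (4 : ℝ) = 2 ^ 2 by norm_num, Real.sqrt_sq (by norm_num)],
      Real.sqrt_eq_rpow, Real.mul_rpow hw0.le (by linarith), Real.rpow_neg hw0.le,
      Real.rpow_neg (by linarith : (0 : ℝ) ≤ 1 - w)]
    have hw' : 0 < w ^ (1 / 2 : ℝ) := Real.rpow_pos_of_pos hw0 _
    have hw'' : 0 < (1 - w) ^ (1 / 2 : ℝ) := Real.rpow_pos_of_pos (by linarith) _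
    field_simp
  rw [intervalIntegral.integral_eq_sub_of_hasDerivAt_of_le zero_le_one
    (Real.continuous_arcsin.comp (by fun_prop)).continuousOn hderiv
    intervalIntegrable_rpow_neg_half_mul]
  norm_num [Real.arcsin_one, Real.arcsin_neg_one]

/-- Scaled Beta integral: for `u > 0`, `∫_0^u v^{-1/2} (u - v)^{-1/2} dv = π`. [folklore] -/
theorem integral_rpow_neg_half_mul_sub {u : ℝ} (hu : 0 < u) :
    ∫ v in (0 : ℝ)..u, v ^ (-(1 / 2 : ℝ)) * (u - v) ^ (-(1 / 2 : ℝ)) = π := by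
  have key : ∀ x ∈ uIcc (0 : ℝ) 1, (u * x) ^ (-(1 / 2 : ℝ)) * (u - u * x) ^ (-(1 / 2 : ℝ)) =
      u⁻¹ * (x ^ (-(1 / 2 : ℝ)) * (1 - x) ^ (-(1 / 2 : ℝ))) := by
    intro x hx
    rw [uIcc_of_le zero_le_one] at hx
    rcases hx with ⟨hx0, hx1⟩
    rw [show u - u * x = u * (1 - x) by ring, Real.mul_rpow hu.le hx0,
      Real.mul_rpow hu.le (by linarith), Real.rpow_neg hu.le]
    have : (u ^ (1 / 2 : ℝ))⁻¹ * (u ^ (1 / 2 : ℝ))⁻¹ = u⁻¹ := by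
      rw [← mul_inv, ← Real.rpow_add hu]; norm_num
    calc (u ^ (1 / 2 : ℝ))⁻¹ * x ^ (-(1 / 2 : ℝ)) * ((u ^ (1 / 2 : ℝ))⁻¹ * (1 - x) ^ (-(1 / 2 : ℝ)))
        = ((u ^ (1 / 2 : ℝ))⁻¹ * (u ^ (1 / 2 : ℝ))⁻¹) * (x ^ (-(1 / 2 : ℝ)) * (1 - x) ^ (-(1 / 2 : ℝ))) := by
          ring
      _ = _ := by rw [this]
  have h := intervalIntegral.integral_comp_mul_left
    (fun v : ℝ => v ^ (-(1 / 2 : ℝ)) * (u - v) ^ (-(1 / 2 : ℝ))) hu.ne' (a := 0) (b := 1)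
  simp only [mul_zero, mul_one] at h
  rw [intervalIntegral.integral_congr key, intervalIntegral.integral_const_mul,
    integral_rpow_neg_half_mul, smul_eq_mul] at h
  field_simp at h
  linarith [h]

/-- Scaled Beta integrand is interval integrable on `[0, u]`. [folklore] -/
theorem intervalIntegrable_rpow_neg_half_mul_sub {u : ℝ} (hu : 0 < u) :
    IntervalIntegrable (fun v : ℝ => v ^ (-(1 / 2 : ℝ)) * (u - v) ^ (-(1 / 2 : ℝ))) volume 0 u := by
  have h := (intervalIntegrable_rpow_neg_half_mul.comp_mul_left (c := u⁻¹))
  rw [zero_div, div_inv_eq_mul, one_mul] at h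
  have h2 := h.const_mul u⁻¹
  refine (h2.congr ?_)
  rw [Set.uIoc_of_le hu.le]
  intro v hv
  rcases hv with ⟨hv0, hvu⟩
  simp only
  rw [show 1 - u⁻¹ * v = u⁻¹ * (u - v) by field_simp, Real.mul_rpow (inv_nonneg.mpr hu.le) hv0.le,
    Real.mul_rpow (inv_nonneg.mpr hu.le) (by linarith), Real.rpow_neg (inv_nonneg.mpr hu.le),
    Real.inv_rpow hu.le]
  have hu' : 0 < u ^ (1 / 2 : ℝ) := Real.rpow_pos_of_pos hu _
  have : u⁻¹ * ((u ^ (1 / 2 : ℝ))⁻¹)⁻¹ * ((u ^ (1 / 2 : ℝ))⁻¹)⁻¹ = 1 := by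
    rw [inv_inv, mul_assoc, ← Real.rpow_add hu]; norm_num; field_simp
  calc u⁻¹ * (((u ^ (1 / 2 : ℝ))⁻¹)⁻¹ * v ^ (-(1 / 2 : ℝ)) * (((u ^ (1 / 2 : ℝ))⁻¹)⁻¹ * (u - v) ^ (-(1 / 2 : ℝ))))
      = (u⁻¹ * ((u ^ (1 / 2 : ℝ))⁻¹)⁻¹ * ((u ^ (1 / 2 : ℝ))⁻¹)⁻¹) * (v ^ (-(1 / 2 : ℝ)) * (u - v) ^ (-(1 / 2 : ℝ))) := by ring
    _ = _ := by rw [this, one_mul]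


/-! ## Test kernels: measurable, bounded, compactly supported in `[0, ∞)` -/

/-- The class of kernel functions `k(u)`, `u ≥ 0`, for which the elementary theory of (1.62) below is
developed: `k` measurable, bounded, and vanishing for `u ≥ M` (compact support; only the values of
`k` on `[0, ∞)` enter `q`, `g`, `h`). It contains the test kernels of Chapter 12 and characteristic
functions of segments (§7.2). [cite: Iwaniec2002, §1.8 & §7.2, PDF pp. 24, 73] -/
structure IsTestKernel (k : ℝ → ℝ) : Prop where
  measurable : Measurable k
  bounded : ∃ B, ∀ u, |k u| ≤ B
  eventually_zero : ∃ M, 0 ≤ M ∧ ∀ u, M ≤ u → k u = 0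

section TestKernel

variable {k : ℝ → ℝ} {B M : ℝ}

/-- The integrand `k(u)(u - v)^{-1/2}` of `q(v)` is integrable on `(v, ∞)`. [folklore] -/
theorem integrableOn_selbergQ_integrand (hk : Measurable k) (hB : ∀ u, |k u| ≤ B)
    (hM : ∀ u, M ≤ u → k u = 0) (v : ℝ) :
    IntegrableOn (fun u => k u * (u - v) ^ (-(1 / 2 : ℝ))) (Ioi v) := by
  have hsplit : Ioi v = Ioc v (max v M) ∪ Ioi (max v M) :=
    (Ioc_union_Ioi_eq_Ioi (le_max_left v M)).symm
  rw [hsplit]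
  refine IntegrableOn.union ?_ ?_
  · have h1 : IntervalIntegrable (fun u => (u - v) ^ (-(1 / 2 : ℝ))) volume v (max v M) := by
      have := (intervalIntegral.intervalIntegrable_rpow' (a := 0) (b := max v M - v)
        (r := -(1 / 2 : ℝ)) (by norm_num)).comp_sub_right v
      simpa using this
    have hint : IntegrableOn (fun u => B * (u - v) ^ (-(1 / 2 : ℝ))) (Ioc v (max v M)) :=
      (h1.const_mul B).1
    refine hint.mono' (hk.mul (by fun_prop)).aestronglyMeasurable ?_
    filter_upwards [ae_restrict_mem measurableSet_Ioc] with u hu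
    have hu0 : 0 ≤ (u - v) ^ (-(1 / 2 : ℝ)) := Real.rpow_nonneg (by linarith [hu.1]) _
    rw [Real.norm_eq_abs, abs_mul, abs_of_nonneg hu0]
    exact mul_le_mul_of_nonneg_right (hB u) hu0
  · refine integrableOn_zero.congr_fun ?_ measurableSet_Ioi
    intro u hu
    simp [hM u ((le_max_right v M).trans (le_of_lt hu))]

/-- `q(v) = 0` for `v ≥ M` if `k` vanishes on `[M, ∞)`. [folklore] -/
theorem selbergQ_eq_zero (hM : ∀ u, M ≤ u → k u = 0) {v : ℝ} (hv : M ≤ v) : selbergQ k v = 0 := by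
  unfold selbergQ
  apply setIntegral_eq_zero_of_forall_eq_zero
  intro u hu
  simp [hM u (hv.trans (le_of_lt hu))]

/-- `|q(v)| ≤ 2 B √M` for `v ≥ 0` (`|k| ≤ B`, `k = 0` on `[M, ∞)`). [folklore] -/
theorem abs_selbergQ_le (hk : Measurable k) (hB : ∀ u, |k u| ≤ B) (hM : ∀ u, M ≤ u → k u = 0)
    (hM0 : 0 ≤ M) {v : ℝ} (hv : 0 ≤ v) : |selbergQ k v| ≤ 2 * B * Real.sqrt M := by
  have hB0 : 0 ≤ B := (abs_nonneg _).trans (hB 0)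
  set M' := max v M with hM'
  have hvM' : v ≤ M' := le_max_left v M
  have hsplit : Ioi v = Ioc v M' ∪ Ioi M' := (Ioc_union_Ioi_eq_Ioi hvM').symm
  have hint := integrableOn_selbergQ_integrand hk hB hM v
  have hzero : ∫ u in Ioi M', k u * (u - v) ^ (-(1 / 2 : ℝ)) = 0 := by
    apply setIntegral_eq_zero_of_forall_eq_zero
    intro u hu
    simp [hM u ((le_max_right v M).trans (le_of_lt hu))]
  have h1 : IntervalIntegrable (fun u => (u - v) ^ (-(1 / 2 : ℝ))) volume v M' := by
    have := (intervalIntegral.intervalIntegrable_rpow' (a := 0) (b := M' - v)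
      (r := -(1 / 2 : ℝ)) (by norm_num)).comp_sub_right v
    simpa using this
  have hval : ∫ u in v..M', (u - v) ^ (-(1 / 2 : ℝ)) = 2 * (M' - v) ^ (1 / 2 : ℝ) := by
    rw [intervalIntegral.integral_comp_sub_right (fun u => u ^ (-(1 / 2 : ℝ))) v, sub_self,
      integral_rpow (Or.inl (by norm_num))]
    rw [Real.zero_rpow (by norm_num)]
    norm_num
    ring
  unfold selbergQ
  rw [hsplit, setIntegral_union (Ioc_disjoint_Ioi le_rfl) measurableSet_Ioi
    (hint.mono_set (by rw [hsplit]; exact subset_union_left))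
    (hint.mono_set (by rw [hsplit]; exact subset_union_right)), hzero, add_zero,
    ← intervalIntegral.integral_of_le hvM']
  calc |∫ u in v..M', k u * (u - v) ^ (-(1 / 2 : ℝ))|
      ≤ ∫ u in v..M', B * (u - v) ^ (-(1 / 2 : ℝ)) := by
        rw [← Real.norm_eq_abs]
        apply intervalIntegral.norm_integral_le_of_norm_le hvM' _ (h1.const_mul B)
        refine ae_of_all _ fun u hu => ?_
        have hu0 : 0 ≤ (u - v) ^ (-(1 / 2 : ℝ)) := Real.rpow_nonneg (by linarith [hu.1]) _
        rw [Real.norm_eq_abs, abs_mul, abs_of_nonneg hu0]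
        exact mul_le_mul_of_nonneg_right (hB u) hu0
    _ = B * (2 * (M' - v) ^ (1 / 2 : ℝ)) := by
        rw [intervalIntegral.integral_const_mul, hval]
    _ ≤ B * (2 * Real.sqrt M) := by
        apply mul_le_mul_of_nonneg_left _ hB0
        apply mul_le_mul_of_nonneg_left _ (by norm_num)
        rw [Real.sqrt_eq_rpow]
        apply Real.rpow_le_rpow (by linarith) _ (by norm_num)
        rcases le_total v M with h | h
        · rw [hM', max_eq_right h]; linarith
        · rw [hM', max_eq_left h]; linarith
    _ = 2 * B * Real.sqrt M := by ring

/-- `q` as a parametric integral over `ℝ` of a jointly measurable integrand. [folklore] -/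
theorem selbergQ_eq_integral_ite (v : ℝ) :
    selbergQ k v = ∫ u, (if v < u then k u * (u - v) ^ (-(1 / 2 : ℝ)) else 0) := by
  unfold selbergQ
  rw [← integral_indicator measurableSet_Ioi]
  congr 1 with u

/-- `q` is measurable (for measurable `k`). [folklore] -/
theorem measurable_selbergQ (hk : Measurable k) : Measurable (selbergQ k) := by
  have hF : Measurable (fun p : ℝ × ℝ =>
      if p.1 < p.2 then k p.2 * (p.2 - p.1) ^ (-(1 / 2 : ℝ)) else 0) := by
    refine Measurable.ite (measurableSet_lt measurable_fst measurable_snd) ?_ measurable_const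
    exact (hk.comp measurable_snd).mul ((measurable_snd.sub measurable_fst).pow_const _)
  have h := hF.stronglyMeasurable.integral_prod_right' (ν := (volume : Measure ℝ))
  have e : selbergQ k = fun v => ∫ u : ℝ, (if v < u then k u * (u - v) ^ (-(1 / 2 : ℝ)) else 0) := by
    funext v; exact selbergQ_eq_integral_ite v
  rw [e]
  exact h.measurable

/-- `g` is even. [folklore] -/
theorem selbergG_neg (r : ℝ) : selbergG k (-r) = selbergG k r := by
  simp [selbergG, neg_div, Real.sinh_neg]

/-- `g` is measurable. [folklore] -/
theorem measurable_selbergG (hk : Measurable k) : Measurable (selbergG k) := by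
  unfold selbergG
  exact ((measurable_selbergQ hk).comp (by fun_prop)).const_mul 2

/-- `g(r) = 0` for `|r| ≥ 2 arsinh √M` (i.e. `sinh²(r/2) ≥ M`). [folklore] -/
theorem selbergG_eq_zero (hM : ∀ u, M ≤ u → k u = 0) (hM0 : 0 ≤ M) {r : ℝ}
    (hr : 2 * Real.arsinh (Real.sqrt M) ≤ |r|) : selbergG k r = 0 := by
  unfold selbergG
  rw [selbergQ_eq_zero hM ?_, mul_zero]
  have h1 : Real.arsinh (Real.sqrt M) ≤ |r| / 2 := by linarith
  have h2 : Real.sqrt M ≤ Real.sinh (|r| / 2) := by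
    rw [← Real.sinh_arsinh (Real.sqrt M)]
    exact Real.sinh_le_sinh.mpr h1
  have h3 : Real.sinh (|r| / 2) ^ 2 = Real.sinh (r / 2) ^ 2 := by
    rcases abs_choice r with h | h
    · rw [h]
    · rw [h, neg_div, Real.sinh_neg, neg_sq]
  calc M = Real.sqrt M ^ 2 := (Real.sq_sqrt hM0).symm
    _ ≤ Real.sinh (|r| / 2) ^ 2 := pow_le_pow_left₀ (Real.sqrt_nonneg _) h2 2
    _ = Real.sinh (r / 2) ^ 2 := h3

/-- `|g(r)| ≤ 4 B √M`. [folklore] -/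
theorem abs_selbergG_le (hk : Measurable k) (hB : ∀ u, |k u| ≤ B) (hM : ∀ u, M ≤ u → k u = 0)
    (hM0 : 0 ≤ M) (r : ℝ) : |selbergG k r| ≤ 4 * B * Real.sqrt M := by
  unfold selbergG
  rw [abs_mul, abs_two]
  have := abs_selbergQ_le hk hB hM hM0 (sq_nonneg (Real.sinh (r / 2)))
  linarith

/-- For a test kernel and a continuous weight `φ`, `φ · g` is integrable over `ℝ` (bounded,
measurable, compactly supported). [folklore] -/
theorem integrable_mul_selbergG (hk : Measurable k) (hB : ∀ u, |k u| ≤ B)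
    (hM : ∀ u, M ≤ u → k u = 0) (hM0 : 0 ≤ M) {φ : ℝ → ℝ} (hφ : Continuous φ) :
    Integrable (fun r => φ r * selbergG k r) := by
  set R := 2 * Real.arsinh (Real.sqrt M)
  have hsupp : Function.support (fun r => φ r * selbergG k r) ⊆ Icc (-R) R := by
    intro r hr
    by_contra hnot
    apply hr
    simp only [mem_Icc, not_and_or, not_le] at hnot
    have hR : R ≤ |r| := by
      rcases hnot with h | h
      · have : r < 0 := by
          have : 0 ≤ R :=
            mul_nonneg zero_le_two (Real.arsinh_nonneg_iff.mpr (Real.sqrt_nonneg _))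
          linarith
        rw [abs_of_neg this]; linarith
      · exact le_trans h.le (le_abs_self r)
    simp [selbergG_eq_zero hM hM0 hR]
  rw [← integrableOn_iff_integrable_of_support_subset hsupp]
  obtain ⟨C, hC⟩ := (isCompact_Icc : IsCompact (Icc (-R) R)).exists_bound_of_continuousOn
    hφ.continuousOn
  refine Measure.integrableOn_of_bounded (M := C * (4 * B * Real.sqrt M)) measure_Icc_lt_top.ne
    ((hφ.measurable.mul (measurable_selbergG hk)).aestronglyMeasurable) ?_
  filter_upwards [ae_restrict_mem measurableSet_Icc] with r hr
  rw [norm_mul, Real.norm_eq_abs (selbergG k r)]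
  exact mul_le_mul (hC r hr) (abs_selbergG_le hk hB hM hM0 r) (abs_nonneg _)
    ((norm_nonneg _).trans (hC r hr))

/-- Complex-weight version of `integrable_mul_selbergG`: `φ · g` is integrable for continuous
`φ : ℝ → ℂ`; in particular the integral defining `h(t)` converges for every `t ∈ ℂ`. [folklore] -/
theorem integrable_mul_selbergG_complex (hk : Measurable k) (hB : ∀ u, |k u| ≤ B)
    (hM : ∀ u, M ≤ u → k u = 0) (hM0 : 0 ≤ M) {φ : ℝ → ℂ} (hφ : Continuous φ) :
    Integrable (fun r => φ r * (selbergG k r : ℂ)) := by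
  set R := 2 * Real.arsinh (Real.sqrt M)
  have hsupp : Function.support (fun r => φ r * (selbergG k r : ℂ)) ⊆ Icc (-R) R := by
    intro r hr
    by_contra hnot
    apply hr
    simp only [mem_Icc, not_and_or, not_le] at hnot
    have hR : R ≤ |r| := by
      rcases hnot with h | h
      · have : r < 0 := by
          have : 0 ≤ R :=
            mul_nonneg zero_le_two (Real.arsinh_nonneg_iff.mpr (Real.sqrt_nonneg _))
          linarith
        rw [abs_of_neg this]; linarith
      · exact le_trans h.le (le_abs_self r)
    simp [selbergG_eq_zero hM hM0 hR]
  rw [← integrableOn_iff_integrable_of_support_subset hsupp]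
  obtain ⟨C, hC⟩ := (isCompact_Icc : IsCompact (Icc (-R) R)).exists_bound_of_continuousOn
    hφ.continuousOn
  refine Measure.integrableOn_of_bounded (M := C * (4 * B * Real.sqrt M)) measure_Icc_lt_top.ne
    ((hφ.measurable.mul (Complex.measurable_ofReal.comp (measurable_selbergG hk))).aestronglyMeasurable) ?_
  filter_upwards [ae_restrict_mem measurableSet_Icc] with r hr
  rw [norm_mul, Complex.norm_real, Real.norm_eq_abs]
  exact mul_le_mul (hC r hr) (abs_selbergG_le hk hB hM hM0 r) (abs_nonneg _)
    ((norm_nonneg _).trans (hC r hr))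

/-! ## `h(i/2) = 4π ∫ k`: the eigenvalue on constants is the mass of the kernel -/

/-- Step 1 (evenness of `g`): `∫_ℝ e^{-r/2} g(r) dr = ∫_0^∞ 2 cosh(r/2) g(r) dr`. [folklore] -/
theorem integral_exp_mul_selbergG (hk : Measurable k) (hB : ∀ u, |k u| ≤ B)
    (hM : ∀ u, M ≤ u → k u = 0) (hM0 : 0 ≤ M) :
    ∫ r, Real.exp (-(r / 2)) * selbergG k r =
      ∫ r in Ioi 0, 2 * Real.cosh (r / 2) * selbergG k r := by
  have hint : Integrable (fun r => Real.exp (-(r / 2)) * selbergG k r) :=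
    integrable_mul_selbergG hk hB hM hM0 (by fun_prop)
  have hint' : Integrable (fun r => Real.exp (r / 2) * selbergG k r) :=
    integrable_mul_selbergG hk hB hM hM0 (by fun_prop)
  rw [← setIntegral_univ, ← Iic_union_Ioi (a := (0 : ℝ)),
    setIntegral_union (Iic_disjoint_Ioi le_rfl) measurableSet_Ioi hint.integrableOn hint.integrableOn]
  have h1 : ∫ r in Iic 0, Real.exp (-(r / 2)) * selbergG k r =
      ∫ r in Ioi 0, Real.exp (r / 2) * selbergG k r := by
    rw [show Iic (0 : ℝ) = Iic (-0) by rw [neg_zero], ← integral_comp_neg_Ioi]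
    congr 1 with r
    rw [selbergG_neg]
    congr 2
    ring
  rw [h1, ← integral_add hint'.integrableOn hint.integrableOn]
  congr 1 with r
  rw [Real.cosh_eq]
  ring

/-- Step 2 (change of variables `v = sinh²(r/2)`):
`∫_0^∞ 2 cosh(r/2) g(r) dr = 4 ∫_0^∞ q(v) v^{-1/2} dv`. [folklore] -/
theorem integral_cosh_mul_selbergG (k : ℝ → ℝ) :
    ∫ r in Ioi 0, 2 * Real.cosh (r / 2) * selbergG k r =
      4 * ∫ v in Ioi 0, selbergQ k v * v ^ (-(1 / 2 : ℝ)) := by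
  set φ : ℝ → ℝ := fun r => Real.sinh (r / 2) ^ 2 with hφ
  have hderiv : ∀ r ∈ Ioi (0 : ℝ),
      HasDerivWithinAt φ (Real.sinh (r / 2) * Real.cosh (r / 2)) (Ioi 0) r := by
    intro r _
    apply HasDerivAt.hasDerivWithinAt
    have h1 : HasDerivAt (fun r : ℝ => r / 2) (1 / 2) r := by
      simpa using (hasDerivAt_id r).div_const (2 : ℝ)
    have h2 := (Real.hasDerivAt_sinh (r / 2)).comp r h1
    have h3 := h2.pow 2
    refine h3.congr_deriv ?_
    simp
    ring
  have hinj : InjOn φ (Ioi 0) := by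
    intro a ha b hb hab
    simp only [hφ] at hab
    have ha' : 0 < Real.sinh (a / 2) := Real.sinh_pos_iff.mpr (by simpa using ha)
    have hb' : 0 < Real.sinh (b / 2) := Real.sinh_pos_iff.mpr (by simpa using hb)
    have := (pow_left_inj₀ ha'.le hb'.le two_ne_zero).mp hab
    have := Real.sinh_injective this
    linarith
  have himage : φ '' Ioi 0 = Ioi 0 := by
    ext v
    constructor
    · rintro ⟨r, hr, rfl⟩
      exact pow_pos (Real.sinh_pos_iff.mpr (by simpa using hr)) 2
    · intro hv
      refine ⟨2 * Real.arsinh (Real.sqrt v), ?_, ?_⟩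
      · have : 0 < Real.arsinh (Real.sqrt v) := Real.arsinh_pos_iff.mpr (Real.sqrt_pos.mpr hv)
        simpa using (by linarith : (0 : ℝ) < 2 * Real.arsinh (Real.sqrt v))
      · simp only [hφ]
        rw [show 2 * Real.arsinh (Real.sqrt v) / 2 = Real.arsinh (Real.sqrt v) by ring,
          Real.sinh_arsinh, Real.sq_sqrt hv.le]
  have h := integral_image_eq_integral_abs_deriv_smul measurableSet_Ioi hderiv hinj
    (fun v => selbergQ k v * v ^ (-(1 / 2 : ℝ)))
  rw [himage] at h
  calc ∫ r in Ioi 0, 2 * Real.cosh (r / 2) * selbergG k r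
      = ∫ r in Ioi 0, 4 * (Real.cosh (r / 2) * selbergQ k (Real.sinh (r / 2) ^ 2)) := by
        congr 1 with r; unfold selbergG; ring
    _ = 4 * ∫ r in Ioi 0, Real.cosh (r / 2) * selbergQ k (Real.sinh (r / 2) ^ 2) :=
        integral_const_mul _ _
    _ = 4 * ∫ v in Ioi 0, selbergQ k v * v ^ (-(1 / 2 : ℝ)) := by
        rw [h]
        congr 1
        apply setIntegral_congr_fun measurableSet_Ioi
        intro r hr
        have hs : 0 < Real.sinh (r / 2) := Real.sinh_pos_iff.mpr (by simpa using hr)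
        have hc : 0 < Real.cosh (r / 2) := Real.cosh_pos _
        simp only [hφ, smul_eq_mul]
        rw [abs_of_pos (mul_pos hs hc), Real.rpow_neg (sq_nonneg _), ← Real.sqrt_eq_rpow,
          Real.sqrt_sq hs.le]
        field_simp

/-- Step 3 (Fubini and `B(1/2,1/2) = π`): `∫_0^∞ q(v) v^{-1/2} dv = π ∫_0^∞ k(u) du`. [folklore] -/
theorem integral_selbergQ_mul_rpow (hk : Measurable k) (hB : ∀ u, |k u| ≤ B)
    (hM : ∀ u, M ≤ u → k u = 0) :
    ∫ v in Ioi 0, selbergQ k v * v ^ (-(1 / 2 : ℝ)) = π * ∫ u in Ioi 0, k u := by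
  have hB0 : 0 ≤ B := (abs_nonneg _).trans (hB 0)
  set F : ℝ × ℝ → ℝ := fun p =>
    if 0 < p.1 ∧ p.1 < p.2 then k p.2 * (p.1 ^ (-(1 / 2 : ℝ)) * (p.2 - p.1) ^ (-(1 / 2 : ℝ))) else 0
    with hF
  have hFm : Measurable F := by
    refine Measurable.ite ?_ ?_ measurable_const
    · exact (measurableSet_lt measurable_const measurable_fst).inter
        (measurableSet_lt measurable_fst measurable_snd)
    · exact (hk.comp measurable_snd).mul
        ((measurable_fst.pow_const _).mul ((measurable_snd.sub measurable_fst).pow_const _))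
  -- the sections `v ↦ F (v, u)`
  have hsec : ∀ u : ℝ, (fun v => F (v, u)) =
      (Ioo 0 u).indicator (fun v => k u * (v ^ (-(1 / 2 : ℝ)) * (u - v) ^ (-(1 / 2 : ℝ)))) := by
    intro u; funext v
    simp only [hF, Set.indicator_apply, mem_Ioo]
  have hsec_norm : ∀ u : ℝ, (fun v => ‖F (v, u)‖) =
      (Ioo 0 u).indicator (fun v => |k u| * (v ^ (-(1 / 2 : ℝ)) * (u - v) ^ (-(1 / 2 : ℝ)))) := by
    intro u; funext v
    simp only [hF, Set.indicator_apply, mem_Ioo]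
    split_ifs with h
    · rw [Real.norm_eq_abs, abs_mul, abs_of_nonneg
        (mul_nonneg (Real.rpow_nonneg h.1.le _) (Real.rpow_nonneg (by linarith [h.2]) _))]
    · simp
  have hint_sec : ∀ u : ℝ, 0 < u → ∀ c : ℝ,
      Integrable ((Ioo 0 u).indicator (fun v => c * (v ^ (-(1 / 2 : ℝ)) * (u - v) ^ (-(1 / 2 : ℝ))))) := by
    intro u hu c
    rw [integrable_indicator_iff measurableSet_Ioo]
    have h := ((intervalIntegrable_rpow_neg_half_mul_sub hu).const_mul c).1
    exact h.mono_set Ioo_subset_Ioc_self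
  have hval_sec : ∀ u : ℝ, 0 < u → ∀ c : ℝ,
      ∫ v, (Ioo 0 u).indicator (fun v => c * (v ^ (-(1 / 2 : ℝ)) * (u - v) ^ (-(1 / 2 : ℝ)))) v = c * π := by
    intro u hu c
    rw [integral_indicator measurableSet_Ioo, integral_const_mul, ← integral_Ioc_eq_integral_Ioo,
      ← intervalIntegral.integral_of_le hu.le, integral_rpow_neg_half_mul_sub hu]
  have hFint : Integrable F (volume.prod volume) := by
    rw [integrable_prod_iff' hFm.aestronglyMeasurable]
    constructor
    · refine ae_of_all _ fun u => ?_
      change Integrable (fun v => F (v, u))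
      rw [hsec u]
      by_cases hu : 0 < u
      · exact hint_sec u hu (k u)
      · have : Ioo (0 : ℝ) u = ∅ := Ioo_eq_empty (by simpa using hu)
        rw [this, Set.indicator_empty']
        exact integrable_zero _ _ _
    · have e : (fun u => ∫ v, ‖F (v, u)‖) = (Ioc 0 M).indicator (fun u => |k u| * π) := by
        funext u
        change ∫ v, (fun v => ‖F (v, u)‖) v = _
        rw [hsec_norm u]
        by_cases hu : 0 < u
        · rw [hval_sec u hu |k u|]
          simp only [Set.indicator_apply, mem_Ioc, hu, true_and]
          split_ifs with h
          · rfl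
          · rw [hM u (le_of_lt (not_le.mp h)), abs_zero, zero_mul]
        · have : Ioo (0 : ℝ) u = ∅ := Ioo_eq_empty (by simpa using hu)
          rw [this, Set.indicator_empty', Set.indicator_of_notMem]
          · simp
          · simp [hu]
      rw [e, integrable_indicator_iff measurableSet_Ioc]
      refine Measure.integrableOn_of_bounded (M := B * π) measure_Ioc_lt_top.ne ?_ ?_
      · exact ((continuous_abs.measurable.comp hk).mul_const _).aestronglyMeasurable
      · refine ae_of_all _ fun u => ?_
        rw [Real.norm_eq_abs, abs_mul, abs_abs, abs_of_pos Real.pi_pos]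
        exact mul_le_mul_of_nonneg_right (hB u) Real.pi_pos.le
  -- left-hand side as an iterated integral of `F`
  have hL : ∫ v in Ioi 0, selbergQ k v * v ^ (-(1 / 2 : ℝ)) = ∫ v, ∫ u, F (v, u) := by
    rw [← integral_indicator measurableSet_Ioi]
    congr 1 with v
    by_cases hv : 0 < v
    · rw [Set.indicator_of_mem (mem_Ioi.mpr hv)]
      unfold selbergQ
      rw [← integral_indicator measurableSet_Ioi, ← integral_mul_const]
      congr 1 with u
      simp only [Set.indicator_apply, mem_Ioi, hF, hv, true_and]
      split_ifs <;> ring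
    · rw [Set.indicator_of_notMem (by simpa using hv)]
      simp [hF, hv]
  -- right-hand side
  have hR : ∫ u, ∫ v, F (v, u) = π * ∫ u in Ioi 0, k u := by
    have e : (fun u => ∫ v, F (v, u)) = (Ioi 0).indicator (fun u => π * k u) := by
      funext u
      change ∫ v, (fun v => F (v, u)) v = _
      rw [hsec u]
      by_cases hu : 0 < u
      · rw [hval_sec u hu (k u), Set.indicator_of_mem (mem_Ioi.mpr hu)]
        ring
      · have : Ioo (0 : ℝ) u = ∅ := Ioo_eq_empty (by simpa using hu)
        rw [this, Set.indicator_empty', Set.indicator_of_notMem (by simpa using hu)]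
        simp
    rw [e, integral_indicator measurableSet_Ioi, integral_const_mul]
  rw [hL, integral_integral_swap (f := fun v u => F (v, u)) hFint, hR]

/-- **The Selberg/Harish-Chandra transform at `t = i/2` is the mass of the kernel**:
`h(i/2) = ∫_ℍ k(u(i, z)) dμz = 4π ∫_0^∞ k(u) du` for every test kernel `k` (Iwaniec, proof of
Theorem 1.16 with `s = 0`, and §7.2, p. 73: "for `s = 0` this gives `h(i/2) = ∫_ℍ k(i, z) dμz`";
this is the eigenvalue of the invariant integral operator `k` on the constant eigenfunction,
`λ = 0`, `s = 1`, and produces the main term `2π|F|⁻¹ X` of Theorem 12.1). Proof here directly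
from (1.62): `h(i/2) = ∫ e^{-r/2} g = 4 ∫_0^∞ q(v) v^{-1/2} dv = 4 ∫_0^∞ k(u) B(1/2, 1/2) du`.
[cite: Iwaniec2002, Thm 1.16 & §7.2, PDF pp. 24, 73] -/
theorem selbergTransform_I_half (hk : IsTestKernel k) :
    selbergTransform k (Complex.I / 2) = ((4 * π * ∫ u in Ioi 0, k u : ℝ) : ℂ) := by
  obtain ⟨hkm, ⟨B, hB⟩, ⟨M, hM0, hM⟩⟩ := hk
  unfold selbergTransform
  have e : ∀ r : ℝ, Complex.exp (Complex.I * r * (Complex.I / 2)) * (selbergG k r : ℂ) =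
      ((Real.exp (-(r / 2)) * selbergG k r : ℝ) : ℂ) := by
    intro r
    have : Complex.I * r * (Complex.I / 2) = ((-(r / 2) : ℝ) : ℂ) := by
      rw [show Complex.I * r * (Complex.I / 2) = Complex.I * Complex.I * (r / 2) by ring,
        Complex.I_mul_I]
      push_cast
      ring
    rw [this, ← Complex.ofReal_exp]
    push_cast
    ring
  simp_rw [e]
  rw [integral_complex_ofReal, integral_exp_mul_selbergG hkm hB hM hM0, integral_cosh_mul_selbergG,
    integral_selbergQ_mul_rpow hkm hB hM]
  push_cast
  ring


/-! ## `h` is even and entire -/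

/-- `h(-t) = h(t)` (because `g` is even). [cite: Iwaniec2002, (1.63), PDF p. 24] -/
theorem selbergTransform_neg (k : ℝ → ℝ) (t : ℂ) :
    selbergTransform k (-t) = selbergTransform k t := by
  unfold selbergTransform
  rw [← integral_neg_eq_self]
  congr 1 with r
  rw [selbergG_neg]
  push_cast
  ring_nf

/-- For a test kernel, `h` is entire: `d/dt ∫ e^{irt} g(r) dr = ∫ ir e^{irt} g(r) dr`
(differentiation under the integral sign; `g` is bounded with compact support). [folklore] -/
theorem differentiable_selbergTransform (hk : IsTestKernel k) :
    Differentiable ℂ (selbergTransform k) := by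
  obtain ⟨hkm, ⟨B, hB⟩, ⟨M, hM0, hM⟩⟩ := hk
  intro t₀
  set F : ℂ → ℝ → ℂ := fun t r => Complex.exp (Complex.I * r * t) * (selbergG k r : ℂ) with hF
  set F' : ℂ → ℝ → ℂ := fun t r => (Complex.I * r) * (Complex.exp (Complex.I * r * t) * (selbergG k r : ℂ))
    with hF'
  set φ : ℝ → ℝ := fun r => |r| * Real.exp (|r| * (‖t₀‖ + 1)) with hφ
  have hφc : Continuous φ := by simp only [hφ]; fun_prop
  have hgm : Measurable (fun r : ℝ => (selbergG k r : ℂ)) :=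
    Complex.measurable_ofReal.comp (measurable_selbergG hkm)
  have hF_meas : ∀ t : ℂ, AEStronglyMeasurable (F t) volume := by
    intro t
    simp only [hF]
    exact ((by fun_prop : Measurable fun r : ℝ => Complex.exp (Complex.I * r * t)).mul hgm).aestronglyMeasurable
  have hF_int : Integrable (F t₀) :=
    integrable_mul_selbergG_complex hkm hB hM hM0 (by fun_prop)
  have hF'_meas : AEStronglyMeasurable (F' t₀) volume := by
    simp only [hF']
    exact ((by fun_prop : Measurable fun r : ℝ => Complex.I * (r : ℂ)).mul
      ((by fun_prop : Measurable fun r : ℝ => Complex.exp (Complex.I * r * t₀)).mul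
        hgm)).aestronglyMeasurable
  have hbound_int : Integrable (fun r => ‖φ r * selbergG k r‖) :=
    (integrable_mul_selbergG hkm hB hM hM0 hφc).norm
  have h_bound : ∀ᵐ r ∂volume, ∀ t ∈ Metric.ball t₀ 1, ‖F' t r‖ ≤ ‖φ r * selbergG k r‖ := by
    refine ae_of_all _ fun r t ht => ?_
    have hre : (Complex.I * r * t).re = -(r * t.im) := by
      simp [Complex.mul_re, Complex.mul_im]
    have hL : ‖F' t r‖ = |r| * (Real.exp (-(r * t.im)) * |selbergG k r|) := by
      simp only [hF']
      rw [norm_mul, norm_mul, norm_mul, Complex.norm_I, one_mul, Complex.norm_real,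
        Complex.norm_real, Complex.norm_exp, Real.norm_eq_abs, Real.norm_eq_abs, hre]
    have hR : ‖φ r * selbergG k r‖ = |r| * Real.exp (|r| * (‖t₀‖ + 1)) * |selbergG k r| := by
      simp only [hφ]
      rw [Real.norm_eq_abs, abs_mul, abs_mul, abs_abs, Real.abs_exp]
    rw [hL, hR]
    have ht' : ‖t‖ ≤ ‖t₀‖ + 1 := by
      have := Metric.mem_ball.mp ht
      rw [dist_eq_norm] at this
      calc ‖t‖ = ‖(t - t₀) + t₀‖ := by ring_nf
        _ ≤ ‖t - t₀‖ + ‖t₀‖ := norm_add_le _ _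
        _ ≤ ‖t₀‖ + 1 := by linarith
    have him : |t.im| ≤ ‖t₀‖ + 1 := (Complex.abs_im_le_norm t).trans ht'
    have hexp : Real.exp (-(r * t.im)) ≤ Real.exp (|r| * (‖t₀‖ + 1)) := by
      apply Real.exp_le_exp.mpr
      calc -(r * t.im) ≤ |r * t.im| := neg_le_abs _
        _ = |r| * |t.im| := abs_mul _ _
        _ ≤ |r| * (‖t₀‖ + 1) := mul_le_mul_of_nonneg_left him (abs_nonneg _)
    have h1 : 0 ≤ |r| := abs_nonneg _
    have h2 : 0 ≤ |selbergG k r| := abs_nonneg _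
    calc |r| * (Real.exp (-(r * t.im)) * |selbergG k r|)
        ≤ |r| * (Real.exp (|r| * (‖t₀‖ + 1)) * |selbergG k r|) := by gcongr
      _ = |r| * Real.exp (|r| * (‖t₀‖ + 1)) * |selbergG k r| := by ring
  have h_diff : ∀ᵐ r ∂volume, ∀ t ∈ Metric.ball t₀ 1, HasDerivAt (F · r) (F' t r) t := by
    refine ae_of_all _ fun r t _ => ?_
    simp only [hF, hF']
    have h1 : HasDerivAt (fun t : ℂ => Complex.I * r * t) (Complex.I * r) t := by
      simpa using (hasDerivAt_id t).const_mul (Complex.I * r)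
    have h2 := (Complex.hasDerivAt_exp (Complex.I * r * t)).comp t h1
    have h3 := h2.mul_const (selbergG k r : ℂ)
    refine h3.congr_deriv ?_
    ring
  exact (hasDerivAt_integral_of_dominated_loc_of_deriv_le (Metric.ball_mem_nhds t₀ one_pos)
    (Filter.Eventually.of_forall hF_meas) hF_int hF'_meas h_bound hbound_int h_diff).2.differentiableAt

end TestKernel

/-! ## Admissible transforms: the conditions (1.63) -/

/-- Iwaniec's conditions (1.63) on a Selberg/Harish-Chandra transform `h`: `h` is even,
holomorphic in the strip `|Im t| ≤ 1/2 + ε` and `h(t) ≪ (|t| + 1)^{-2-ε}` in the strip, for some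
`ε > 0`. (We use the open strip `|Im t| < 1/2 + ε`; shrinking `ε` shows the two formulations are
equivalent.) These are the hypotheses of the spectral expansion of automorphic kernels, Theorem 7.4
/ (7.17), hence of (12.5). [cite: Iwaniec2002, (1.63), PDF p. 24] -/
structure IsAdmissibleTransform (h : ℂ → ℂ) : Prop where
  even : ∀ t, h (-t) = h t
  holo_decay : ∃ ε : ℝ, 0 < ε ∧ DifferentiableOn ℂ h {t : ℂ | |t.im| < 1 / 2 + ε} ∧
    ∃ A : ℝ, ∀ t : ℂ, |t.im| < 1 / 2 + ε → ‖h t‖ ≤ A * (‖t‖ + 1) ^ (-(2 + ε))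

/-- For a test kernel the first two conditions of (1.63) are automatic; admissibility reduces to
the decay `h(t) ≪ (|t| + 1)^{-2-ε}` in a strip `|Im t| < 1/2 + ε`. [cite: Iwaniec2002, (1.63), PDF p. 24] -/
theorem isAdmissibleTransform_of_decay {k : ℝ → ℝ} (hk : IsTestKernel k) {ε A : ℝ} (hε : 0 < ε)
    (hdecay : ∀ t : ℂ, |t.im| < 1 / 2 + ε →
      ‖selbergTransform k t‖ ≤ A * (‖t‖ + 1) ^ (-(2 + ε))) :
    IsAdmissibleTransform (selbergTransform k) :=
  ⟨selbergTransform_neg k, ε, hε, (differentiable_selbergTransform hk).differentiableOn, A, hdecay⟩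

/-! ## The test kernel of the hyperbolic circle problem (Chapter 12, Fig. 11) -/

section LatticeKernel

/-- The test function `k(u)` of Iwaniec's proof of Theorem 12.1 (Fig. 11): `k(u) = 1` for
`4u + 2 ≤ X`, `k(u) = 0` for `4u + 2 ≥ X + Y`, and linear in between, with parameters
`X ≥ 2Y ≥ 2`. Since `k ≥ 𝟙_{4u+2 ≤ X}`, the automorphic kernel majorises the count:
`P(X) ≤ 2K(z, w)` (12.7); the kernel with `X` replaced by `X - Y` minorises it.
[cite: Iwaniec2002, proof of Thm 12.1, Fig. 11 & (12.7), PDF p. 126] -/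
def latticeKernel (X Y u : ℝ) : ℝ :=
  min 1 (max 0 ((X + Y - 2 - 4 * u) / Y))

variable {X Y : ℝ}

/-- `0 ≤ k ≤ 1`. [folklore] -/
theorem latticeKernel_nonneg (X Y u : ℝ) : 0 ≤ latticeKernel X Y u :=
  le_min zero_le_one (le_max_left _ _)

/-- `k ≤ 1`. [folklore] -/
theorem latticeKernel_le_one (X Y u : ℝ) : latticeKernel X Y u ≤ 1 := min_le_left _ _

/-- `k(u) = 1` for `4u + 2 ≤ X`. [cite: Iwaniec2002, Fig. 11, PDF p. 126] -/
theorem latticeKernel_eq_one (hY : 0 < Y) {u : ℝ} (hu : 4 * u + 2 ≤ X) : latticeKernel X Y u = 1 := by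
  unfold latticeKernel
  apply min_eq_left
  refine le_trans ?_ (le_max_right _ _)
  rw [le_div_iff₀ hY]
  linarith

/-- `k(u) = 0` for `4u + 2 ≥ X + Y`. [cite: Iwaniec2002, Fig. 11, PDF p. 126] -/
theorem latticeKernel_eq_zero (hY : 0 < Y) {u : ℝ} (hu : X + Y ≤ 4 * u + 2) :
    latticeKernel X Y u = 0 := by
  unfold latticeKernel
  rw [max_eq_left, min_eq_right zero_le_one]
  rw [div_nonpos_iff]
  right
  constructor <;> linarith

/-- On the ramp `X ≤ 4u + 2 ≤ X + Y`, `k(u) = (X + Y - 2 - 4u)/Y`. [cite: Iwaniec2002, Fig. 11, PDF p. 126] -/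
theorem latticeKernel_eq_of_mem (hY : 0 < Y) {u : ℝ} (h1 : X ≤ 4 * u + 2) (h2 : 4 * u + 2 ≤ X + Y) :
    latticeKernel X Y u = (X + Y - 2 - 4 * u) / Y := by
  unfold latticeKernel
  rw [max_eq_right (div_nonneg (by linarith) hY.le), min_eq_right]
  rw [div_le_one hY]
  linarith

/-- `k` is continuous. [folklore] -/
theorem continuous_latticeKernel (X Y : ℝ) : Continuous (latticeKernel X Y) := by
  unfold latticeKernel
  fun_prop

/-- `𝟙_{4u+2 ≤ X} ≤ k_{X,Y}(u)`: the kernel majorises the sharp cutoff. [cite: Iwaniec2002, (12.7), PDF p. 126] -/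
theorem indicator_le_latticeKernel (hY : 0 < Y) (u : ℝ) :
    Set.indicator {u : ℝ | 4 * u + 2 ≤ X} (fun _ => (1 : ℝ)) u ≤ latticeKernel X Y u := by
  by_cases hu : 4 * u + 2 ≤ X
  · rw [Set.indicator_of_mem (by exact hu), latticeKernel_eq_one hY hu]
  · rw [Set.indicator_of_notMem (by exact hu)]
    exact latticeKernel_nonneg X Y u

/-- `k_{X-Y,Y}(u) ≤ 𝟙_{4u+2 ≤ X}`: the shifted kernel minorises the sharp cutoff.
[cite: Iwaniec2002, proof of Thm 12.1 ("X replaced by X - Y"), PDF p. 126] -/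
theorem latticeKernel_sub_le_indicator (hY : 0 < Y) (u : ℝ) :
    latticeKernel (X - Y) Y u ≤ Set.indicator {u : ℝ | 4 * u + 2 ≤ X} (fun _ => (1 : ℝ)) u := by
  by_cases hu : 4 * u + 2 ≤ X
  · rw [Set.indicator_of_mem (by exact hu)]
    exact latticeKernel_le_one _ _ _
  · rw [Set.indicator_of_notMem (by exact hu), latticeKernel_eq_zero hY (by linarith)]

/-- The Chapter 12 kernel is a test kernel (measurable, `|k| ≤ 1`, `k = 0` for
`u ≥ max 0 ((X + Y - 2)/4)`). [folklore] -/
theorem isTestKernel_latticeKernel (X : ℝ) (hY : 0 < Y) : IsTestKernel (latticeKernel X Y) := by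
  refine ⟨(continuous_latticeKernel X Y).measurable, ⟨1, fun u => ?_⟩,
    ⟨max 0 ((X + Y - 2) / 4), le_max_left _ _, fun u hu => ?_⟩⟩
  · rw [abs_of_nonneg (latticeKernel_nonneg X Y u)]
    exact latticeKernel_le_one X Y u
  · apply latticeKernel_eq_zero hY
    have := (le_max_right _ _).trans hu
    linarith

/-- The mass of the Chapter 12 kernel: `∫_0^∞ k(u) du = (X - 2)/4 + Y/8` (`X ≥ 2`, `Y > 0`). [folklore] -/
theorem integral_latticeKernel (hX : 2 ≤ X) (hY : 0 < Y) :
    ∫ u in Ioi 0, latticeKernel X Y u = (X - 2) / 4 + Y / 8 := by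
  set U₁ := (X - 2) / 4 with hU₁
  set U₂ := (X + Y - 2) / 4 with hU₂
  have hU₁0 : 0 ≤ U₁ := by rw [hU₁]; linarith
  have hU12 : U₁ ≤ U₂ := by rw [hU₁, hU₂]; linarith
  have hc := continuous_latticeKernel X Y
  have hzero : ∫ u in Ioi U₂, latticeKernel X Y u = 0 := by
    apply setIntegral_eq_zero_of_forall_eq_zero
    intro u hu
    apply latticeKernel_eq_zero hY
    have : U₂ < u := hu
    rw [hU₂] at this
    linarith
  have hint : IntegrableOn (latticeKernel X Y) (Ioc 0 U₂) :=
    (hc.integrableOn_Icc (a := 0) (b := U₂)).mono_set Ioc_subset_Icc_self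
  have hint2 : IntegrableOn (latticeKernel X Y) (Ioi U₂) :=
    integrableOn_zero.congr_fun (fun u hu => (latticeKernel_eq_zero hY (by
      have : U₂ < u := hu
      rw [hU₂] at this
      linarith)).symm) measurableSet_Ioi
  rw [← Ioc_union_Ioi_eq_Ioi (hU₁0.trans hU12), setIntegral_union (Ioc_disjoint_Ioi le_rfl)
    measurableSet_Ioi hint hint2, hzero, add_zero, ← intervalIntegral.integral_of_le (hU₁0.trans hU12),
    ← intervalIntegral.integral_add_adjacent_intervals (b := U₁) (hc.intervalIntegrable _ _)
      (hc.intervalIntegrable _ _)]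
  have h1 : ∫ u in (0 : ℝ)..U₁, latticeKernel X Y u = U₁ := by
    rw [intervalIntegral.integral_congr (g := fun _ => (1 : ℝ)), intervalIntegral.integral_const,
      smul_eq_mul, mul_one, sub_zero]
    intro u hu
    rw [uIcc_of_le hU₁0] at hu
    apply latticeKernel_eq_one hY
    have := hu.2
    rw [hU₁] at this
    linarith
  have h2 : ∫ u in U₁..U₂, latticeKernel X Y u = Y / 8 := by
    have hderiv : ∀ u ∈ Ioo U₁ U₂, HasDerivAt (fun u : ℝ => ((X + Y - 2) * u - 2 * u ^ 2) / Y)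
        (latticeKernel X Y u) u := by
      intro u hu
      rw [latticeKernel_eq_of_mem hY (by rw [hU₁] at hu; linarith [hu.1])
        (by rw [hU₂] at hu; linarith [hu.2])]
      have h := (((hasDerivAt_id u).const_mul (X + Y - 2)).sub
        ((hasDerivAt_pow 2 u).const_mul 2)).div_const Y
      refine h.congr_deriv ?_
      simp
      ring
    rw [intervalIntegral.integral_eq_sub_of_hasDerivAt_of_le hU12 (by fun_prop) hderiv
      (hc.intervalIntegrable _ _)]
    rw [hU₁, hU₂]
    field_simp
    ring
  rw [h1, h2]

/-- **(12.8) at `s = 1`, exactly**: the transform of the Chapter 12 kernel at `t = i/2` is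
`h(i/2) = 4π ∫ k = π (X - 2 + Y/2) = π^{1/2} Γ(1/2)/Γ(2) · X + O(Y)`. This is the only value of
`h` off the critical line that the modular group needs (its small spectrum is `{s₀ = 1}`).
[cite: Iwaniec2002, (12.8), PDF p. 126] -/
theorem selbergTransform_latticeKernel_I_half (hX : 2 ≤ X) (hY : 0 < Y) :
    selbergTransform (latticeKernel X Y) (Complex.I / 2) = ((π * (X - 2 + Y / 2) : ℝ) : ℂ) := by
  rw [selbergTransform_I_half (isTestKernel_latticeKernel X hY), integral_latticeKernel hX hY]
  push_cast
  ring

end LatticeKernel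

/-! ## The transform estimates (12.8)–(12.9) (named facts) -/

section Facts

/-- `|s|` for `s = 1/2 + it`, `t ∈ ℝ`: `|s| = (1/4 + t²)^{1/2}`. [cite: Iwaniec2002, (12.9), PDF p. 126] -/
def specAbs (t : ℝ) : ℝ := Real.sqrt (1 / 4 + t ^ 2)

/-- `specAbs t = |1/2 + it|`. [folklore] -/
theorem specAbs_eq_norm (t : ℝ) : specAbs t = ‖(1 / 2 : ℂ) + Complex.I * t‖ := by
  rw [specAbs, Complex.norm_def, Complex.normSq_apply]
  congr 1
  simp
  ring

/-- `|s| ≥ 1/2 > 0`. [folklore] -/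
theorem one_half_le_specAbs (t : ℝ) : 1 / 2 ≤ specAbs t := by
  rw [specAbs, show (1 / 2 : ℝ) = Real.sqrt (1 / 4) by
    rw [show (1 / 4 : ℝ) = (1 / 2) ^ 2 by norm_num, Real.sqrt_sq (by norm_num)]]
  exact Real.sqrt_le_sqrt (by nlinarith)

/-- `|s| > 0`. [folklore] -/
theorem specAbs_pos (t : ℝ) : 0 < specAbs t := lt_of_lt_of_le (by norm_num) (one_half_le_specAbs t)

/-- `|t| ≤ |s|`. [folklore] -/
theorem abs_le_specAbs (t : ℝ) : |t| ≤ specAbs t := by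
  rw [specAbs, ← Real.sqrt_sq_eq_abs]
  exact Real.sqrt_le_sqrt (by nlinarith)

/-- `|s| ≤ |t| + 1/2`. [folklore] -/
theorem specAbs_le (t : ℝ) : specAbs t ≤ |t| + 1 / 2 := by
  rw [specAbs, Real.sqrt_le_left (by positivity)]
  nlinarith [abs_nonneg t, sq_abs t]

/-- The right-hand side of (12.9) without the absolute constant:
`H(t) = |s|^{-5/2} (min{|s|, T} + log X) X^{1/2}`, `T = X/Y`, `s = 1/2 + it`.
[cite: Iwaniec2002, (12.9), PDF p. 126] -/
def majorant129 (X Y t : ℝ) : ℝ :=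
  specAbs t ^ (-(5 / 2 : ℝ)) * (min (specAbs t) (X / Y) + Real.log X) * X ^ (1 / 2 : ℝ)

/-- **Iwaniec (12.9)** ("we let the reader prove"): the Selberg/Harish-Chandra transform of the
kernel of Fig. 11 satisfies, for `X ≥ 2Y ≥ 2` and real `t` (i.e. `Re s = 1/2`, `s = 1/2 + it`),
`h(t) ≪ |s|^{-5/2} (min{|s|, T} + log X) X^{1/2}` with `T = XY⁻¹` and an absolute implied
constant. (Numerically the ratio `|h(t)|` / right-hand side stays below `7` for
`X ≤ 10⁵`, `0 ≤ t ≤ 3000`.) [cite: Iwaniec2002, (12.9), PDF p. 126] -/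
def Iwaniec2002_eq_12_9 : Prop :=
  ∃ C : ℝ, ∀ X Y : ℝ, 1 ≤ Y → 2 * Y ≤ X → ∀ t : ℝ,
    ‖selbergTransform (latticeKernel X Y) t‖ ≤ C * majorant129 X Y t

/-- **Iwaniec (12.8)** ("we let the reader prove"): for `1/2 < s ≤ 1` (`t = i(s - 1/2)`, `h`
even) and `X ≥ 2Y ≥ 2`, `h(t) = π^{1/2} Γ(s - 1/2)/Γ(s + 1) X^s + O(Y + X^{1/2})`, the implied
constant depending on `s`. At `s = 1` this is `selbergTransform_latticeKernel_I_half` (proved,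
exactly `π(X - 2 + Y/2)`). [cite: Iwaniec2002, (12.8), PDF p. 126] -/
def Iwaniec2002_eq_12_8 : Prop :=
  ∀ s : ℝ, 1 / 2 < s → s ≤ 1 → ∃ C : ℝ, ∀ X Y : ℝ, 1 ≤ Y → 2 * Y ≤ X →
    ‖selbergTransform (latticeKernel X Y) (Complex.I * (s - 1 / 2 : ℝ)) -
        ((Real.sqrt π * Real.Gamma (s - 1 / 2) / Real.Gamma (s + 1) * X ^ s : ℝ) : ℂ)‖ ≤
      C * (Y + X ^ (1 / 2 : ℝ))

/-- (12.8) at `s = 1` holds (with constant `2π`): `|h(i/2) - π^{1/2} Γ(1/2)/Γ(2) X| =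
`|π(Y/2 - 2)| ≤ 2π (Y + X^{1/2})`. [cite: Iwaniec2002, (12.8), PDF p. 126] -/
theorem Iwaniec2002_eq_12_8_one :
    ∃ C : ℝ, ∀ X Y : ℝ, 1 ≤ Y → 2 * Y ≤ X →
      ‖selbergTransform (latticeKernel X Y) (Complex.I * ((1 : ℝ) - 1 / 2 : ℝ)) -
          ((Real.sqrt π * Real.Gamma (1 - 1 / 2) / Real.Gamma (1 + 1) * X ^ (1 : ℝ) : ℝ) : ℂ)‖ ≤
        C * (Y + X ^ (1 / 2 : ℝ)) := by
  refine ⟨2 * π, fun X Y hY hXY => ?_⟩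
  have hX : 2 ≤ X := by linarith
  have e : Complex.I * (((1 : ℝ) - 1 / 2 : ℝ) : ℂ) = Complex.I / 2 := by push_cast; ring
  rw [e, selbergTransform_latticeKernel_I_half hX (by linarith), show (1 : ℝ) - 1 / 2 = 1 / 2 by norm_num,
    Real.Gamma_one_half_eq, show (1 : ℝ) + 1 = 2 by norm_num, Real.Gamma_two, div_one,
    Real.mul_self_sqrt Real.pi_pos.le, Real.rpow_one, ← Complex.ofReal_sub, Complex.norm_real,
    Real.norm_eq_abs, show π * (X - 2 + Y / 2) - π * X = π * (Y / 2 - 2) by ring, abs_mul,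
    abs_of_pos Real.pi_pos]
  have hX0 : 0 ≤ X ^ (1 / 2 : ℝ) := Real.rpow_nonneg (by linarith) _
  have : |Y / 2 - 2| ≤ 2 * (Y + X ^ (1 / 2 : ℝ)) := by
    rw [abs_le]; constructor <;> linarith
  calc π * |Y / 2 - 2| ≤ π * (2 * (Y + X ^ (1 / 2 : ℝ))) :=
        mul_le_mul_of_nonneg_left this Real.pi_pos.le
    _ = 2 * π * (Y + X ^ (1 / 2 : ℝ)) := by ring

/-- **The kernel of Fig. 11 is admissible for the pretrace formula** (implicit in Iwaniec's proof
of Theorem 12.1, which applies (12.5) — i.e. Theorem 7.4, hypotheses (1.63) — to this kernel): its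
transform is even and entire (`isAdmissibleTransform_of_decay` reduces this to decay), and decays
like `|t|^{-5/2}` in every horizontal strip because `g ∈ C¹` with `g''` having only inverse
square-root singularities (the mechanism behind (12.9)). Named fact; only the decay in a strip
`|Im t| < 1/2 + ε` remains to be proved. [cite: Iwaniec2002, proof of Thm 12.1 via (12.5) & (1.63), PDF pp. 24, 126] -/
def Iwaniec2002_latticeKernel_admissible : Prop :=
  ∀ X Y : ℝ, 1 ≤ Y → 2 * Y ≤ X → IsAdmissibleTransform (selbergTransform (latticeKernel X Y))


/-! ### Calculus of the majorant `H(t)` of (12.9): monotonicity and `∫_0^∞ (t+1) H(t) dt` -/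

variable {X Y : ℝ}

/-- `H ≥ 0` (for `X ≥ 1`, `Y > 0`). [folklore] -/
theorem majorant129_nonneg (hX : 1 ≤ X) (hY : 0 < Y) (t : ℝ) : 0 ≤ majorant129 X Y t := by
  unfold majorant129
  have h1 : 0 ≤ specAbs t ^ (-(5 / 2 : ℝ)) := Real.rpow_nonneg (specAbs_pos t).le _
  have h2 : 0 ≤ min (specAbs t) (X / Y) := le_min (specAbs_pos t).le (div_nonneg (by linarith) hY.le)
  have h3 : 0 ≤ Real.log X := Real.log_nonneg hX
  have h4 : 0 ≤ X ^ (1 / 2 : ℝ) := Real.rpow_nonneg (by linarith) _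
  positivity

/-- `H` is measurable in `t`. [folklore] -/
theorem measurable_majorant129 (X Y : ℝ) : Measurable (majorant129 X Y) := by
  unfold majorant129 specAbs
  fun_prop

/-- The profile `a ↦ a^{-5/2} (min{a, T} + L) = min{a^{-3/2}, T a^{-5/2}} + L a^{-5/2}` is
non-increasing on `a > 0` (`T, L ≥ 0`). [folklore] -/
theorem rpow_neg_mul_min_add_antitone {T L a b : ℝ} (hT : 0 ≤ T) (hL : 0 ≤ L) (ha : 0 < a)
    (hab : a ≤ b) :
    b ^ (-(5 / 2 : ℝ)) * (min b T + L) ≤ a ^ (-(5 / 2 : ℝ)) * (min a T + L) := by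
  have hb : 0 < b := lt_of_lt_of_le ha hab
  have key : ∀ x : ℝ, 0 < x → x ^ (-(5 / 2 : ℝ)) * (min x T + L) =
      min (x ^ (-(3 / 2 : ℝ))) (T * x ^ (-(5 / 2 : ℝ))) + L * x ^ (-(5 / 2 : ℝ)) := by
    intro x hx
    rw [mul_add, mul_min_of_nonneg _ _ (Real.rpow_nonneg hx.le _)]
    congr 1
    · congr 1
      · rw [show x ^ (-(3 / 2 : ℝ)) = x ^ (-(5 / 2 : ℝ) + 1) by norm_num, Real.rpow_add hx,
          Real.rpow_one]
      · ring
    · ring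
  rw [key a ha, key b hb]
  have h5 : b ^ (-(5 / 2 : ℝ)) ≤ a ^ (-(5 / 2 : ℝ)) :=
    Real.rpow_le_rpow_of_nonpos ha hab (by norm_num)
  have h3 : b ^ (-(3 / 2 : ℝ)) ≤ a ^ (-(3 / 2 : ℝ)) :=
    Real.rpow_le_rpow_of_nonpos ha hab (by norm_num)
  gcongr

/-- **`H` is a decreasing majorant** (as required in (12.5)): `t ↦ H(t)` is non-increasing on
`[0, ∞)` (for `X ≥ 1`, `Y > 0`). [cite: Iwaniec2002, (12.5), PDF pp. 125–126] -/
theorem majorant129_antitoneOn (hX : 1 ≤ X) (hY : 0 < Y) : AntitoneOn (majorant129 X Y) (Ici 0) := by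
  intro a ha b hb hab
  unfold majorant129
  have hsab : specAbs a ≤ specAbs b := by
    unfold specAbs
    apply Real.sqrt_le_sqrt
    have : a ^ 2 ≤ b ^ 2 := pow_le_pow_left₀ ha hab 2
    linarith
  have h := rpow_neg_mul_min_add_antitone (T := X / Y) (L := Real.log X)
    (div_nonneg (by linarith) hY.le) (Real.log_nonneg hX) (specAbs_pos a) hsab
  exact mul_le_mul_of_nonneg_right h (Real.rpow_nonneg (by linarith) _)

/-- Pointwise bound for `t ≤ 1`:
`(t+1) H(t) ≤ 2 ((1/2)^{-3/2} + (1/2)^{-5/2} log X) X^{1/2}`. [folklore] -/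
theorem majorant129_bound_small (hX : 1 ≤ X) (hY : 0 < Y) {t : ℝ} (ht1 : t ≤ 1) :
    (t + 1) * majorant129 X Y t ≤
      2 * ((1 / 2 : ℝ) ^ (-(3 / 2 : ℝ)) + (1 / 2 : ℝ) ^ (-(5 / 2 : ℝ)) * Real.log X) * X ^ (1 / 2 : ℝ) := by
  unfold majorant129
  set A := specAbs t
  have hA : 1 / 2 ≤ A := one_half_le_specAbs t
  have hApos : 0 < A := specAbs_pos t
  have hL : 0 ≤ Real.log X := Real.log_nonneg hX
  have hS : 0 ≤ X ^ (1 / 2 : ℝ) := Real.rpow_nonneg (by linarith) _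
  have h5 : A ^ (-(5 / 2 : ℝ)) ≤ (1 / 2 : ℝ) ^ (-(5 / 2 : ℝ)) :=
    Real.rpow_le_rpow_of_nonpos (by norm_num) hA (by norm_num)
  have h3 : A ^ (-(3 / 2 : ℝ)) ≤ (1 / 2 : ℝ) ^ (-(3 / 2 : ℝ)) :=
    Real.rpow_le_rpow_of_nonpos (by norm_num) hA (by norm_num)
  have hmin : A ^ (-(5 / 2 : ℝ)) * min A (X / Y) ≤ (1 / 2 : ℝ) ^ (-(3 / 2 : ℝ)) := by
    calc A ^ (-(5 / 2 : ℝ)) * min A (X / Y) ≤ A ^ (-(5 / 2 : ℝ)) * A :=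
          mul_le_mul_of_nonneg_left (min_le_left _ _) (Real.rpow_nonneg hApos.le _)
      _ = A ^ (-(3 / 2 : ℝ)) := by
          rw [show A ^ (-(3 / 2 : ℝ)) = A ^ (-(5 / 2 : ℝ) + 1) by norm_num, Real.rpow_add hApos,
            Real.rpow_one]
      _ ≤ _ := h3
  have hcore : A ^ (-(5 / 2 : ℝ)) * (min A (X / Y) + Real.log X) ≤
      (1 / 2 : ℝ) ^ (-(3 / 2 : ℝ)) + (1 / 2 : ℝ) ^ (-(5 / 2 : ℝ)) * Real.log X := by
    rw [mul_add]
    gcongr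
  have ht2 : t + 1 ≤ 2 := by linarith
  have hcore0 : 0 ≤ A ^ (-(5 / 2 : ℝ)) * (min A (X / Y) + Real.log X) :=
    mul_nonneg (Real.rpow_nonneg hApos.le _)
      (add_nonneg (le_min hApos.le (div_nonneg (by linarith) hY.le)) hL)
  calc (t + 1) * (A ^ (-(5 / 2 : ℝ)) * (min A (X / Y) + Real.log X) * X ^ (1 / 2 : ℝ))
      = (t + 1) * (A ^ (-(5 / 2 : ℝ)) * (min A (X / Y) + Real.log X)) * X ^ (1 / 2 : ℝ) := by ring
    _ ≤ 2 * ((1 / 2 : ℝ) ^ (-(3 / 2 : ℝ)) + (1 / 2 : ℝ) ^ (-(5 / 2 : ℝ)) * Real.log X) * X ^ (1 / 2 : ℝ) := by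
      gcongr

/-- Pointwise bound for `t ≥ 1` using `min{|s|, T} ≤ |s|`:
`(t+1) H(t) ≤ 2 X^{1/2} t^{-1/2} + 2 (log X) X^{1/2} t^{-3/2}`. [folklore] -/
theorem majorant129_bound_mid (hX : 1 ≤ X) (hY : 0 < Y) {t : ℝ} (ht1 : 1 ≤ t) :
    (t + 1) * majorant129 X Y t ≤
      2 * X ^ (1 / 2 : ℝ) * t ^ (-(1 / 2 : ℝ)) + 2 * Real.log X * X ^ (1 / 2 : ℝ) * t ^ (-(3 / 2 : ℝ)) := by
  unfold majorant129
  set A := specAbs t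
  have htpos : 0 < t := by linarith
  have htA : t ≤ A := (le_abs_self t).trans (abs_le_specAbs t)
  have hApos : 0 < A := specAbs_pos t
  have hL : 0 ≤ Real.log X := Real.log_nonneg hX
  have hS : 0 ≤ X ^ (1 / 2 : ℝ) := Real.rpow_nonneg (by linarith) _
  have h5 : A ^ (-(5 / 2 : ℝ)) ≤ t ^ (-(5 / 2 : ℝ)) := Real.rpow_le_rpow_of_nonpos htpos htA (by norm_num)
  have h3 : A ^ (-(3 / 2 : ℝ)) ≤ t ^ (-(3 / 2 : ℝ)) := Real.rpow_le_rpow_of_nonpos htpos htA (by norm_num)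
  have hmin : A ^ (-(5 / 2 : ℝ)) * min A (X / Y) ≤ t ^ (-(3 / 2 : ℝ)) := by
    calc A ^ (-(5 / 2 : ℝ)) * min A (X / Y) ≤ A ^ (-(5 / 2 : ℝ)) * A :=
          mul_le_mul_of_nonneg_left (min_le_left _ _) (Real.rpow_nonneg hApos.le _)
      _ = A ^ (-(3 / 2 : ℝ)) := by
          rw [show A ^ (-(3 / 2 : ℝ)) = A ^ (-(5 / 2 : ℝ) + 1) by norm_num, Real.rpow_add hApos,
            Real.rpow_one]
      _ ≤ _ := h3
  have e1 : t * t ^ (-(3 / 2 : ℝ)) = t ^ (-(1 / 2 : ℝ)) := by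
    rw [show t ^ (-(1 / 2 : ℝ)) = t ^ ((1 : ℝ) + -(3 / 2 : ℝ)) by norm_num, Real.rpow_add htpos,
      Real.rpow_one]
  have e2 : t * t ^ (-(5 / 2 : ℝ)) = t ^ (-(3 / 2 : ℝ)) := by
    rw [show t ^ (-(3 / 2 : ℝ)) = t ^ ((1 : ℝ) + -(5 / 2 : ℝ)) by norm_num, Real.rpow_add htpos,
      Real.rpow_one]
  have ht2 : t + 1 ≤ 2 * t := by linarith
  calc (t + 1) * (A ^ (-(5 / 2 : ℝ)) * (min A (X / Y) + Real.log X) * X ^ (1 / 2 : ℝ))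
      = (t + 1) * (A ^ (-(5 / 2 : ℝ)) * min A (X / Y) + Real.log X * A ^ (-(5 / 2 : ℝ))) *
          X ^ (1 / 2 : ℝ) := by ring
    _ ≤ (2 * t) * (t ^ (-(3 / 2 : ℝ)) + Real.log X * t ^ (-(5 / 2 : ℝ))) * X ^ (1 / 2 : ℝ) := by
      gcongr
    _ = 2 * X ^ (1 / 2 : ℝ) * (t * t ^ (-(3 / 2 : ℝ))) +
          2 * Real.log X * X ^ (1 / 2 : ℝ) * (t * t ^ (-(5 / 2 : ℝ))) := by ring
    _ = _ := by rw [e1, e2]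

/-- Pointwise bound for `t ≥ max{1, T}` using `min{|s|, T} ≤ T`:
`(t+1) H(t) ≤ 2 T X^{1/2} t^{-3/2} + 2 (log X) X^{1/2} t^{-3/2}`. [folklore] -/
theorem majorant129_bound_large (hX : 1 ≤ X) (hY : 0 < Y) {t : ℝ} (ht1 : 1 ≤ t) :
    (t + 1) * majorant129 X Y t ≤
      2 * (X / Y) * X ^ (1 / 2 : ℝ) * t ^ (-(3 / 2 : ℝ)) +
        2 * Real.log X * X ^ (1 / 2 : ℝ) * t ^ (-(3 / 2 : ℝ)) := by
  unfold majorant129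
  set A := specAbs t
  have htpos : 0 < t := by linarith
  have htA : t ≤ A := (le_abs_self t).trans (abs_le_specAbs t)
  have hApos : 0 < A := specAbs_pos t
  have hL : 0 ≤ Real.log X := Real.log_nonneg hX
  have hT : 0 ≤ X / Y := div_nonneg (by linarith) hY.le
  have hS : 0 ≤ X ^ (1 / 2 : ℝ) := Real.rpow_nonneg (by linarith) _
  have h5 : A ^ (-(5 / 2 : ℝ)) ≤ t ^ (-(5 / 2 : ℝ)) := Real.rpow_le_rpow_of_nonpos htpos htA (by norm_num)
  have hmin : A ^ (-(5 / 2 : ℝ)) * min A (X / Y) ≤ (X / Y) * t ^ (-(5 / 2 : ℝ)) := by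
    calc A ^ (-(5 / 2 : ℝ)) * min A (X / Y) ≤ A ^ (-(5 / 2 : ℝ)) * (X / Y) :=
          mul_le_mul_of_nonneg_left (min_le_right _ _) (Real.rpow_nonneg hApos.le _)
      _ ≤ t ^ (-(5 / 2 : ℝ)) * (X / Y) := mul_le_mul_of_nonneg_right h5 hT
      _ = _ := by ring
  have e2 : t * t ^ (-(5 / 2 : ℝ)) = t ^ (-(3 / 2 : ℝ)) := by
    rw [show t ^ (-(3 / 2 : ℝ)) = t ^ ((1 : ℝ) + -(5 / 2 : ℝ)) by norm_num, Real.rpow_add htpos,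
      Real.rpow_one]
  have ht2 : t + 1 ≤ 2 * t := by linarith
  calc (t + 1) * (A ^ (-(5 / 2 : ℝ)) * (min A (X / Y) + Real.log X) * X ^ (1 / 2 : ℝ))
      = (t + 1) * (A ^ (-(5 / 2 : ℝ)) * min A (X / Y) + Real.log X * A ^ (-(5 / 2 : ℝ))) *
          X ^ (1 / 2 : ℝ) := by ring
    _ ≤ (2 * t) * ((X / Y) * t ^ (-(5 / 2 : ℝ)) + Real.log X * t ^ (-(5 / 2 : ℝ))) * X ^ (1 / 2 : ℝ) := by
      gcongr
    _ = 2 * (X / Y) * X ^ (1 / 2 : ℝ) * (t * t ^ (-(5 / 2 : ℝ))) +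
          2 * Real.log X * X ^ (1 / 2 : ℝ) * (t * t ^ (-(5 / 2 : ℝ))) := by ring
    _ = _ := by rw [e2]

/-- `H(0) ≤ 2 (1/2)^{-5/2} X^{1/2} log X` (for `X ≥ 2`; uses `log X ≥ log 2 ≥ 1/2`). [folklore] -/
theorem majorant129_zero_le (hX : 2 ≤ X) :
    majorant129 X Y 0 ≤ 2 * (1 / 2 : ℝ) ^ (-(5 / 2 : ℝ)) * (X ^ (1 / 2 : ℝ) * Real.log X) := by
  have hL : 1 / 2 ≤ Real.log X := by
    have h2 : Real.log 2 ≤ Real.log X := Real.log_le_log (by norm_num) hX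
    linarith [Real.log_two_gt_d9]
  have hS : 0 ≤ X ^ (1 / 2 : ℝ) := Real.rpow_nonneg (by linarith) _
  unfold majorant129
  have h0 : specAbs 0 = 1 / 2 := by
    rw [specAbs, show (1 / 4 : ℝ) + 0 ^ 2 = (1 / 2) ^ 2 by norm_num, Real.sqrt_sq (by norm_num)]
  rw [h0]
  have hmin : min (1 / 2 : ℝ) (X / Y) ≤ 1 / 2 := min_le_left _ _
  have hc : 0 ≤ (1 / 2 : ℝ) ^ (-(5 / 2 : ℝ)) := Real.rpow_nonneg (by norm_num) _
  calc (1 / 2 : ℝ) ^ (-(5 / 2 : ℝ)) * (min (1 / 2 : ℝ) (X / Y) + Real.log X) * X ^ (1 / 2 : ℝ)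
      ≤ (1 / 2 : ℝ) ^ (-(5 / 2 : ℝ)) * (Real.log X + Real.log X) * X ^ (1 / 2 : ℝ) := by
        gcongr
        linarith
    _ = 2 * (1 / 2 : ℝ) ^ (-(5 / 2 : ℝ)) * (X ^ (1 / 2 : ℝ) * Real.log X) := by ring

/-- **`∫_0^∞ (t + 1) H(t) dt ≪ X Y^{-1/2} + X^{1/2} log X`** for the majorant `H` of (12.9)
(`X ≥ 2Y ≥ 2`, `T = X/Y`): the error term `O(Y + X Y^{-1/2})` in Iwaniec's proof of Theorem 12.1
comes from this integral (through (12.5)) plus the `O(Y + X^{1/2})` of (12.8). Explicitly, with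
`c₃ = (1/2)^{-3/2}`, `c₅ = (1/2)^{-5/2}`: the integrand is `≤ 2(c₃ + c₅ log X) X^{1/2}` on
`(0, 1]`, `≤ 2X^{1/2} t^{-1/2} + 2 (log X) X^{1/2} t^{-3/2}` on `(1, T]`, and
`≤ 2 T X^{1/2} t^{-3/2} + 2 (log X) X^{1/2} t^{-3/2}` on `(T, ∞)`, whose integrals add up to at most
`8 X^{1/2} T^{1/2} + (4c₃ + 2c₅ + 4) X^{1/2} log X`. [cite: Iwaniec2002, proof of Thm 12.1, PDF p. 126] -/
theorem integral_majorant129_le (hY : 1 ≤ Y) (hXY : 2 * Y ≤ X) :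
    IntegrableOn (fun t => (t + 1) * majorant129 X Y t) (Ioi 0) ∧
      ∫ t in Ioi 0, (t + 1) * majorant129 X Y t ≤
        8 * (X * Y ^ (-(1 / 2 : ℝ))) +
          (4 * (1 / 2 : ℝ) ^ (-(3 / 2 : ℝ)) + 2 * (1 / 2 : ℝ) ^ (-(5 / 2 : ℝ)) + 4) *
            (X ^ (1 / 2 : ℝ) * Real.log X) := by
  have hX2 : 2 ≤ X := by linarith
  have hX1 : 1 ≤ X := by linarith
  have hY0 : 0 < Y := by linarith
  have hXpos : 0 < X := by linarith
  set T := X / Y with hT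
  have hT2 : 2 ≤ T := by rw [hT, le_div_iff₀ hY0]; linarith
  have hT1 : 1 ≤ T := by linarith
  have hTpos : 0 < T := by linarith
  set S := X ^ (1 / 2 : ℝ) with hS
  have hS0 : 0 ≤ S := Real.rpow_nonneg hXpos.le _
  set L := Real.log X with hL
  have hL2 : 1 / 2 ≤ L := by
    have h2 : Real.log 2 ≤ Real.log X := Real.log_le_log (by norm_num) hX2
    rw [hL]; linarith [Real.log_two_gt_d9]
  have hL0 : 0 ≤ L := by linarith
  set c₃ := (1 / 2 : ℝ) ^ (-(3 / 2 : ℝ)) with hc₃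
  set c₅ := (1 / 2 : ℝ) ^ (-(5 / 2 : ℝ)) with hc₅
  have hc₃0 : 0 ≤ c₃ := Real.rpow_nonneg (by norm_num) _
  have hc₅0 : 0 ≤ c₅ := Real.rpow_nonneg (by norm_num) _
  -- the four majorants
  set g₁ : ℝ → ℝ := (Ioc 0 1).indicator fun _ => 2 * (c₃ + c₅ * L) * S with hg₁
  set g₂ : ℝ → ℝ := (Ioc 1 T).indicator fun t => 2 * S * t ^ (-(1 / 2 : ℝ)) with hg₂
  set g₃ : ℝ → ℝ := (Ioi T).indicator fun t => 2 * T * S * t ^ (-(3 / 2 : ℝ)) with hg₃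
  set g₄ : ℝ → ℝ := (Ioi 1).indicator fun t => 2 * L * S * t ^ (-(3 / 2 : ℝ)) with hg₄
  set f : ℝ → ℝ := fun t => (t + 1) * majorant129 X Y t with hf
  -- integrability and integrals of the majorants
  have hi₁ : Integrable g₁ ∧ ∫ t, g₁ t = 2 * (c₃ + c₅ * L) * S := by
    simp only [hg₁]
    rw [integrable_indicator_iff measurableSet_Ioc, integral_indicator measurableSet_Ioc,
      setIntegral_const, Measure.real, Real.volume_Ioc]
    refine ⟨integrableOn_const (by simp), ?_⟩
    simp
  have hi₂ : Integrable g₂ ∧ ∫ t, g₂ t = 4 * S * (T ^ (1 / 2 : ℝ) - 1) := by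
    simp only [hg₂]
    rw [integrable_indicator_iff measurableSet_Ioc, integral_indicator measurableSet_Ioc]
    have hii : IntervalIntegrable (fun t : ℝ => 2 * S * t ^ (-(1 / 2 : ℝ))) volume 1 T :=
      (intervalIntegral.intervalIntegrable_rpow' (by norm_num)).const_mul _
    refine ⟨hii.1, ?_⟩
    rw [← intervalIntegral.integral_of_le hT1, intervalIntegral.integral_const_mul,
      integral_rpow (Or.inl (by norm_num)), Real.one_rpow]
    norm_num
    ring
  have hi₃ : Integrable g₃ ∧ ∫ t, g₃ t = 4 * S * T ^ (1 / 2 : ℝ) := by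
    simp only [hg₃]
    rw [integrable_indicator_iff measurableSet_Ioi, integral_indicator measurableSet_Ioi]
    refine ⟨(integrableOn_Ioi_rpow_of_lt (by norm_num) hTpos).const_mul _, ?_⟩
    rw [integral_const_mul, integral_Ioi_rpow_of_lt (by norm_num) hTpos]
    have e : T * T ^ (-(3 / 2 : ℝ) + 1) = T ^ (1 / 2 : ℝ) := by
      rw [show -(3 / 2 : ℝ) + 1 = -(1 / 2 : ℝ) by norm_num,
        show T ^ (1 / 2 : ℝ) = T ^ ((1 : ℝ) + -(1 / 2 : ℝ)) by norm_num, Real.rpow_add hTpos,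
        Real.rpow_one]
    calc 2 * T * S * (-T ^ (-(3 / 2 : ℝ) + 1) / (-(3 / 2 : ℝ) + 1))
        = 4 * S * (T * T ^ (-(3 / 2 : ℝ) + 1)) := by ring
      _ = _ := by rw [e]
  have hi₄ : Integrable g₄ ∧ ∫ t, g₄ t = 4 * L * S := by
    simp only [hg₄]
    rw [integrable_indicator_iff measurableSet_Ioi, integral_indicator measurableSet_Ioi]
    refine ⟨(integrableOn_Ioi_rpow_of_lt (by norm_num) one_pos).const_mul _, ?_⟩
    rw [integral_const_mul, integral_Ioi_rpow_of_lt (by norm_num) one_pos, Real.one_rpow]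
    norm_num
    ring
  -- pointwise domination on `Ioi 0`
  have hdom : ∀ t ∈ Ioi (0 : ℝ), f t ≤ g₁ t + g₂ t + g₃ t + g₄ t := by
    intro t ht
    have ht0 : 0 < t := ht
    have g1nn : 0 ≤ g₁ t := by
      simp only [hg₁]; apply Set.indicator_nonneg; intro _ _; positivity
    have g2nn : 0 ≤ g₂ t := by
      simp only [hg₂]; apply Set.indicator_nonneg; intro u hu
      exact mul_nonneg (by positivity) (Real.rpow_nonneg (by linarith [hu.1]) _)
    have g3nn : 0 ≤ g₃ t := by
      simp only [hg₃]; apply Set.indicator_nonneg; intro u hu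
      have : T < u := hu
      exact mul_nonneg (by positivity) (Real.rpow_nonneg (by linarith) _)
    have g4nn : 0 ≤ g₄ t := by
      simp only [hg₄]; apply Set.indicator_nonneg; intro u hu
      have : (1 : ℝ) < u := hu
      exact mul_nonneg (by positivity) (Real.rpow_nonneg (by linarith) _)
    rcases le_or_gt t 1 with h1 | h1
    · -- small
      have := majorant129_bound_small hX1 hY0 h1
      have e1 : g₁ t = 2 * (c₃ + c₅ * L) * S := by
        simp only [hg₁]; rw [Set.indicator_of_mem (by exact ⟨ht0, h1⟩)]
      simp only [hf]
      linarith
    · rcases le_or_gt t T with h2 | h2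
      · -- mid
        have := majorant129_bound_mid hX1 hY0 h1.le
        have e2 : g₂ t = 2 * S * t ^ (-(1 / 2 : ℝ)) := by
          simp only [hg₂]; rw [Set.indicator_of_mem (by exact ⟨h1, h2⟩)]
        have e4 : g₄ t = 2 * L * S * t ^ (-(3 / 2 : ℝ)) := by
          simp only [hg₄]; rw [Set.indicator_of_mem (by exact h1)]
        simp only [hf]
        nlinarith
      · -- large
        have := majorant129_bound_large hX1 hY0 h1.le
        have e3 : g₃ t = 2 * T * S * t ^ (-(3 / 2 : ℝ)) := by
          simp only [hg₃]; rw [Set.indicator_of_mem (by exact h2)]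
        have e4 : g₄ t = 2 * L * S * t ^ (-(3 / 2 : ℝ)) := by
          simp only [hg₄]; rw [Set.indicator_of_mem (by exact h1)]
        simp only [hf]
        nlinarith
  have hI12 : Integrable (fun t => g₁ t + g₂ t) := hi₁.1.add hi₂.1
  have hI123 : Integrable (fun t => g₁ t + g₂ t + g₃ t) := hI12.add hi₃.1
  have hG : Integrable (fun t => g₁ t + g₂ t + g₃ t + g₄ t) := hI123.add hi₄.1
  have hfm : AEStronglyMeasurable f (volume.restrict (Ioi 0)) := by
    simp only [hf]
    exact ((measurable_id.add_const 1).mul (measurable_majorant129 X Y)).aestronglyMeasurable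
  have hfnn : ∀ t ∈ Ioi (0 : ℝ), 0 ≤ f t := by
    intro t ht
    have : (0 : ℝ) < t := ht
    exact mul_nonneg (by linarith) (majorant129_nonneg hX1 hY0 t)
  have hint : IntegrableOn f (Ioi 0) := by
    refine Integrable.mono' hG.integrableOn hfm ?_
    filter_upwards [ae_restrict_mem measurableSet_Ioi] with t ht
    rw [Real.norm_of_nonneg (hfnn t ht)]
    exact hdom t ht
  refine ⟨hint, ?_⟩
  calc ∫ t in Ioi 0, f t ≤ ∫ t in Ioi 0, (g₁ t + g₂ t + g₃ t + g₄ t) :=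
        setIntegral_mono_on hint hG.integrableOn measurableSet_Ioi hdom
    _ ≤ ∫ t, (g₁ t + g₂ t + g₃ t + g₄ t) := by
        apply setIntegral_le_integral hG
        filter_upwards with t
        by_cases ht : t ∈ Ioi (0 : ℝ)
        · exact le_trans (hfnn t ht) (hdom t ht)
        · have ht' : t ≤ 0 := not_lt.mp ht
          simp only [hg₁, hg₂, hg₃, hg₄]
          rw [Set.indicator_of_notMem, Set.indicator_of_notMem, Set.indicator_of_notMem,
            Set.indicator_of_notMem]
          · simp
          · intro h; have : (1 : ℝ) < t := h; linarith
          · intro h; have : T < t := h; linarith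
          · intro h; linarith [h.1]
          · intro h; linarith [h.1]
    _ = 2 * (c₃ + c₅ * L) * S + 4 * S * (T ^ (1 / 2 : ℝ) - 1) + 4 * S * T ^ (1 / 2 : ℝ) + 4 * L * S := by
        rw [integral_add hI123 hi₄.1, integral_add hI12 hi₃.1, integral_add hi₁.1 hi₂.1, hi₁.2,
          hi₂.2, hi₃.2, hi₄.2]
    _ ≤ 8 * (S * T ^ (1 / 2 : ℝ)) + (4 * c₃ + 2 * c₅ + 4) * (S * L) := by
        have hST : 0 ≤ S * T ^ (1 / 2 : ℝ) := mul_nonneg hS0 (Real.rpow_nonneg hTpos.le _)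
        have hSL : S ≤ 2 * (S * L) := by nlinarith
        nlinarith [mul_nonneg hc₃0 hS0, mul_nonneg hc₅0 (mul_nonneg hS0 hL0)]
    _ = _ := by
        have e : S * T ^ (1 / 2 : ℝ) = X * Y ^ (-(1 / 2 : ℝ)) := by
          rw [hS, hT, Real.div_rpow hXpos.le hY0.le, Real.rpow_neg hY0.le]
          rw [← mul_div_assoc, ← Real.rpow_add hXpos]
          norm_num
          rfl
        rw [e]

end Facts

end Literature.NumberTheory.Automorphic

end
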